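import Summits.MatrixMultiplication.MatrixMultiplication.Theorems.FarEdgeDescentTwistDetClass
import Mathlib.Algebra.MvPolynomial.NoZeroDivisors
import HarnessLib

/-!
# `𝔖^♭ᵀ ⋭ 𝔖^♭`: the determinant class of the `y`-pencil

Route `FarEdgeDescent` (cell `decomp-mm`, lens 2 «structural dichotomy (special vs generic)»,
gen 32), Kernel VII concluded; support for the aside `SubLogRate` (stmt-MatrixMultiplication-25371).

`FarEdgeDescentSignTwistComm` shows `𝔖^♭ ⋭ 𝔖^♭ᵀ` (commutant of the `y`-pencil).  Here the
converse: `𝔖^♭ᵀ ⋭ 𝔖^♭` in characteristic `≠ 2`.  Every invariant used so far is symmetric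
or favours `♭ᵀ ⊵ ♭` (`x`-pencil determinant classes `det · perm` for both; `y`/`z`-pencil
commutants `2` versus `1`); what separates them is the DETERMINANT CLASS OF THE `y`-PENCIL:
after moving the `y`-leg to the middle (`yform`, a leg transposition plus a reindexing `eLM`
of the `x`-leg, which degenerations respect: `algDegeneratesTo_yform`) the slice identity of
`FarEdgeDescentSignTwistDet` applies to the `4 × 4` pencils `(z, x)` parametrised by `y`, and

* `det S^y_{♭ᵀ}(y) = 2 · y_{L0} y_{L1} y_{R0} y_{R1}` — a product of four LINEAR forms
  (`det_Smat_yform_signTStar`), whereas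
* `det T^y_{♭}(x) = (x_{L1}x_{R0} - x_{L0}x_{R1})(x_{L1}x_{R0} + x_{L0}x_{R1})` has the PRIME
  quadratic factor `qY` (`det_Tmat_yform_signStar`, `qY_prime`).

Trailing coefficients of the identity give `det T^y_♭ = C(2c) · u₁u₂u₃u₄` with linear forms
`uᵢ`, so the prime quadric `qY` would divide a nonzero linear form — impossible by total
degree (`signTStar_not_algDegeneratesTo_signStar`).  Hence, in characteristic `≠ 2`, the
generic twists `𝔖^♭` and `𝔖^♭ᵀ` are degeneration-incomparable in both directions, which
completes the picture at `N = 1`: the four classes `⟨2,2,2⟩, 𝔖^ᵀ, 𝔖^♭, 𝔖^♭ᵀ` of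
`FarEdgeDescentSignTwist` form an ANTICHAIN for degeneration (`⟨2,2,2⟩`:
`FarEdgeDescentTwistRigidity`, `…SignTwistDet`, `…TwistImage`; `ᵀ`: `…TwistDetClass`; this
file and `…SignTwistComm`), although all four are quantum twins (`…TwistQuantumTwin`).

References: P. Bürgisser, M. Clausen, M. A. Shokrollahi, *Algebraic Complexity Theory* (1997),
(15.19), §20.2 [BurgisserClausenShokrollahi1997]; H. Cohn, C. Umans, SODA 2013, §3
[CohnUmans2013];
M. Bläser, M. Christandl, J. Zuiddam, arXiv:1705.09652, Def. 5 [BlaserChristandlZuiddam2017].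
-/

noncomputable section

open scoped BigOperators Polynomial Matrix

set_option linter.dupNamespace false

namespace Summit.MatrixMultiplication.MatrixMultiplication.Theorems.FarEdgeDescentSignTwistYDet

open Literature.Computability.AlgebraicComplexity
open Summit.MatrixMultiplication.MatrixMultiplication.Theorems.FarEdgeDescentSignTwist
open Summit.MatrixMultiplication.MatrixMultiplication.Theorems.FarEdgeDescentSignTwistDet
open Summit.MatrixMultiplication.MatrixMultiplication.Theorems.FarEdgeDescentTwistedStar

universe u

/-! ## Moving the `y`-leg to the middle -/

section YForm
variable (K : Type u) [Field K]

/-- The reindexing `L_i ↦ (0, i)`, `R_i ↦ (1, i)` of the `x`-positions by leaf indices.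
[folklore] -/
def eLM : Leaf2 ≃ Fin 2 × Fin 2 where
  toFun := Sum.elim (fun z => ((0 : Fin 2), z.1)) (fun z => ((1 : Fin 2), z.1))
  invFun := fun b => if b.1 = 0 then Sum.inl (b.2, 0) else Sum.inr (b.2, 0)
  left_inv := fun a => by
    rcases a with ⟨i, l⟩ | ⟨i, l⟩ <;>
    · obtain rfl : l = 0 := Subsingleton.elim _ _
      simp
  right_inv := fun b => by
    obtain ⟨b₁, b₂⟩ := b
    fin_cases b₁ <;> simp

/-- **The `y`-form** of a tensor `s(z, x, y)` on `Leaf2 × (2×2) × Leaf2`: legs `(z, y, x ∘ eLM)`,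
so the middle leg is `y` and the first and third legs have the same index type. [folklore] -/
def yform (s : Leaf2 → (Fin 2 × Fin 2) → Leaf2 → K) : Leaf2 → Leaf2 → Leaf2 → K :=
  fun a c b => s a (eLM b) c

variable {K}

/-- **Approximate restrictions pass to the `y`-form.**
[cite: BurgisserClausenShokrollahi1997, (15.25)] -/
theorem isApproxRestriction_yform {h : ℕ} {s t : Leaf2 → (Fin 2 × Fin 2) → Leaf2 → K}
    {A : Leaf2 → Leaf2 → K[X]} {B : (Fin 2 × Fin 2) → (Fin 2 × Fin 2) → K[X]}
    {C : Leaf2 → Leaf2 → K[X]} (hd : IsApproxRestriction h s t A B C) :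
    IsApproxRestriction h (yform K s) (yform K t) A C (fun z b => B (eLM z) (eLM b)) := by
  intro x y z j hj
  have hsum : (∑ a, ∑ c, ∑ b, A x a * C y c * B (eLM z) (eLM b) *
      Polynomial.C (yform K s a c b)) =
      ∑ a, ∑ b, ∑ c, A x a * B (eLM z) b * C y c * Polynomial.C (s a b c) := by
    refine Finset.sum_congr rfl fun a _ => ?_
    rw [Finset.sum_comm]
    conv_rhs => rw [← eLM.sum_comp]
    refine Finset.sum_congr rfl fun b _ => Finset.sum_congr rfl fun c _ => ?_
    simp only [yform]
    ring
  rw [hsum]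
  exact hd x (eLM z) y j hj

variable (K) in
/-- **Degenerations pass to the `y`-form.** [cite: BurgisserClausenShokrollahi1997, (15.25)] -/
theorem algDegeneratesTo_yform {s t : Leaf2 → (Fin 2 × Fin 2) → Leaf2 → K}
    (h : AlgDegeneratesTo s t) : AlgDegeneratesTo (yform K s) (yform K t) := by
  obtain ⟨h, A, B, C, hd⟩ := h
  exact ⟨h, A, C, _, isApproxRestriction_yform hd⟩

end YForm

/-! ## The two `y`-pencil determinants -/

section Dets
variable (K : Type u) [Field K]

/-- The enumeration `L0, L1, R0, R1` of `Leaf2`. [folklore] -/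
def e4 : Fin 4 ≃ Leaf2 where
  toFun := ![Sum.inl (0, 0), Sum.inl (1, 0), Sum.inr (0, 0), Sum.inr (1, 0)]
  invFun := Sum.elim (fun z => if z.1 = 0 then 0 else 1) (fun z => if z.1 = 0 then 2 else 3)
  left_inv := fun i => by fin_cases i <;> rfl
  right_inv := fun a => by
    rcases a with ⟨i, l⟩ | ⟨i, l⟩ <;>
    · obtain rfl : l = 0 := Subsingleton.elim _ _
      fin_cases i <;> rfl

/-- **The `y`-pencil of `𝔖^♭ᵀ`** in the enumeration `L0, L1, R0, R1`. [folklore] -/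
theorem Smat_yform_signTStar (y : Leaf2 → (MvPolynomial Leaf2 K)[X]) :
    (Smat (yform K (signTStar K)) y).submatrix e4 e4 =
      !![y (Sum.inl (0, 0)), y (Sum.inl (1, 0)), 0, 0;
         0, 0, y (Sum.inl (0, 0)), y (Sum.inl (1, 0));
         y (Sum.inr (0, 0)), 0, -y (Sum.inr (1, 0)), 0;
         0, y (Sum.inr (0, 0)), 0, y (Sum.inr (1, 0))] := by
  ext i j : 1
  fin_cases i <;> fin_cases j <;>
    simp [Smat, yform, eLM, e4, Fintype.sum_sum_type, Fintype.sum_prod_type, matMulTensor,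
      sgnWeight]
  ring

/-- **`det S^y_{♭ᵀ}(y) = 2 · y_{L0} y_{L1} y_{R0} y_{R1}`** — four linear factors. [folklore] -/
theorem det_Smat_yform_signTStar (y : Leaf2 → (MvPolynomial Leaf2 K)[X]) :
    (Smat (yform K (signTStar K)) y).det =
      2 * (y (Sum.inl (0, 0)) * y (Sum.inl (1, 0)) * y (Sum.inr (0, 0)) *
        y (Sum.inr (1, 0))) := by
  rw [← Matrix.det_submatrix_equiv_self e4, Smat_yform_signTStar]
  simp [Matrix.det_succ_row_zero, Fin.sum_univ_succ, Fin.succAbove]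
  ring

/-- **The `y`-pencil of `𝔖^♭`** in the enumeration `L0, L1, R0, R1`. [folklore] -/
theorem Tmat_yform_signStar :
    (Tmat (yform K (signStar K))).submatrix e4 e4 =
      !![MvPolynomial.X (Sum.inl (0, 0)), MvPolynomial.X (Sum.inl (1, 0)), 0, 0;
         0, 0, MvPolynomial.X (Sum.inl (0, 0)), MvPolynomial.X (Sum.inl (1, 0));
         MvPolynomial.X (Sum.inr (0, 0)), MvPolynomial.X (Sum.inr (1, 0)), 0, 0;
         0, 0, -MvPolynomial.X (Sum.inr (0, 0)), MvPolynomial.X (Sum.inr (1, 0))] := by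
  ext i j : 1
  fin_cases i <;> fin_cases j <;>
    simp [Tmat, yform, eLM, e4, Fintype.sum_sum_type, Fintype.sum_prod_type, matMulTensor,
      sgnWeight]

/-- The prime quadric `x_{L1}x_{R0} - x_{L0}x_{R1}` of the `y`-pencil of `𝔖^♭`. [folklore] -/
def qY : MvPolynomial Leaf2 K :=
  MvPolynomial.X (Sum.inl (1, 0)) * MvPolynomial.X (Sum.inr (0, 0)) -
    MvPolynomial.X (Sum.inl (0, 0)) * MvPolynomial.X (Sum.inr (1, 0))

/-- The cofactor `x_{L1}x_{R0} + x_{L0}x_{R1}`. [folklore] -/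
def pY : MvPolynomial Leaf2 K :=
  MvPolynomial.X (Sum.inl (1, 0)) * MvPolynomial.X (Sum.inr (0, 0)) +
    MvPolynomial.X (Sum.inl (0, 0)) * MvPolynomial.X (Sum.inr (1, 0))

/-- **`det T^y_♭ = qY · pY`.** [folklore] -/
theorem det_Tmat_yform_signStar : (Tmat (yform K (signStar K))).det = qY K * pY K := by
  rw [← Matrix.det_submatrix_equiv_self e4, Tmat_yform_signStar, qY, pY]
  simp [Matrix.det_succ_row_zero, Fin.sum_univ_succ, Fin.succAbove]
  ring

/-- `det T^y_♭ ≠ 0` (value `1` at `x_{L1} = x_{R0} = 1`, `x_{L0} = x_{R1} = 0`). [folklore] -/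
theorem det_Tmat_yform_signStar_ne_zero : (Tmat (yform K (signStar K))).det ≠ 0 := by
  rw [det_Tmat_yform_signStar]
  intro h
  have h1 := congrArg (MvPolynomial.eval (Sum.elim
    (fun z : Fin 2 × Fin 1 => if z.1 = 1 then (1 : K) else 0)
    (fun z => if z.1 = 0 then (1 : K) else 0))) h
  simp [qY, pY] at h1

/-- The index map realising `qY` as a `2 × 2` determinant of distinct variables. [folklore] -/
def ιY : Fin 2 × Fin 2 → Leaf2 := fun p =>
  if p.1 = 0 then Sum.inl (![1, 0] p.2, 0) else Sum.inr (![1, 0] p.2, 0)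

/-- `ιY` is injective. [folklore] -/
theorem ιY_injective : Function.Injective (ιY) := by
  intro x y hxy
  obtain ⟨x₁, x₂⟩ := x
  obtain ⟨y₁, y₂⟩ := y
  fin_cases x₁ <;> fin_cases x₂ <;> fin_cases y₁ <;> fin_cases y₂ <;> simp [ιY] at hxy ⊢

/-- `qY` is the determinant of the matrix of distinct variables indexed by `ιY`. [folklore] -/
theorem qY_eq_det :
    qY K = (Matrix.of fun i j => (MvPolynomial.X (ιY (i, j)) : MvPolynomial Leaf2 K)).det := by
  rw [Matrix.det_fin_two, qY]
  simp [ιY]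

/-- **`qY` is prime.** [folklore] -/
theorem qY_prime : Prime (qY K) := by
  rw [qY_eq_det]
  exact prime_det_of_X (k := K) ιY_injective

/-- `qY` is a quadratic form. [folklore] -/
theorem qY_isHomogeneous : (qY K).IsHomogeneous 2 :=
  ((MvPolynomial.isHomogeneous_X K _).mul (MvPolynomial.isHomogeneous_X K _)).sub
    ((MvPolynomial.isHomogeneous_X K _).mul (MvPolynomial.isHomogeneous_X K _))

variable {K} in
/-- A nonzero quadratic form does not divide a nonzero linear form. [folklore] -/
theorem not_dvd_of_isHomogeneous {σ : Type*} {q w : MvPolynomial σ K} (hq : q.IsHomogeneous 2)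
    (hq0 : q ≠ 0) (hw : w.IsHomogeneous 1) (hw0 : w ≠ 0) : ¬ q ∣ w := by
  intro h
  have h1 := MvPolynomial.totalDegree_le_of_dvd_of_isDomain h hw0
  rw [hq.totalDegree hq0, hw.totalDegree hw0] at h1
  omega

end Dets

/-! ## The theorem -/

section Main
variable (K : Type u) [Field K]

/-- **`𝔖^♭ᵀ ⋭ 𝔖^♭`** (single copy, characteristic `≠ 2`): the `y`-pencil of `𝔖^♭ᵀ` has
determinant `2 ∏ y_c` (linear factors), that of `𝔖^♭` the prime quadric factor `qY`; trailing
coefficients of the slice identity would make `qY` divide a nonzero linear form.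
[cite: BurgisserClausenShokrollahi1997, (15.19), sec. 20.2] -/
theorem signTStar_not_algDegeneratesTo_signStar (h2 : (2 : K) ≠ 0) :
    ¬ AlgDegeneratesTo (signTStar K) (signStar K) := by
  intro h0
  obtain ⟨h, A, B, C, hd⟩ := algDegeneratesTo_yform K h0
  obtain ⟨q, D, hqD, hD0⟩ := slice_identity hd (Equiv.refl _)
  rw [det_Smat_yform_signTStar] at hqD
  have hT0 := det_Tmat_yform_signStar_ne_zero K
  have hD : D.trailingCoeff = (Tmat (yform K (signStar K))).det := by
    have h0' : D.coeff 0 ≠ 0 := by rw [hD0]; exact hT0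
    have hn : D.natTrailingDegree = 0 :=
      Nat.le_zero.mp (Polynomial.natTrailingDegree_le_of_ne_zero h0')
    rw [Polynomial.trailingCoeff, hn, hD0]
  have hX : ∀ n : ℕ, ((Polynomial.X : (MvPolynomial Leaf2 K)[X]) ^ n).trailingCoeff = 1 :=
    fun n => by
    rw [Polynomial.trailingCoeff, Polynomial.natTrailingDegree_X_pow, Polynomial.coeff_X_pow,
      if_pos rfl]
  set c : K := q.coeff (φK Leaf2 q).natTrailingDegree with hc
  have hq : (φK Leaf2 q).trailingCoeff = MvPolynomial.C c := coeff_φK q _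
  have h2C : (2 : (MvPolynomial Leaf2 K)[X]).trailingCoeff = 2 := by
    rw [← Polynomial.C_ofNat, Polynomial.trailingCoeff, Polynomial.natTrailingDegree_C,
      Polynomial.coeff_C_zero]
  have htc := congrArg Polynomial.trailingCoeff hqD
  simp only [Polynomial.trailingCoeff_mul] at htc
  rw [hX, one_mul, hD, hq, h2C] at htc
  -- `htc : det T = C c * (2 * (u₁ * u₂ * u₃ * u₄))`
  set u₁ := (yv B (Sum.inl (0, 0))).trailingCoeff with hu₁
  set u₂ := (yv B (Sum.inl (1, 0))).trailingCoeff with hu₂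
  set u₃ := (yv B (Sum.inr (0, 0))).trailingCoeff with hu₃
  set u₄ := (yv B (Sum.inr (1, 0))).trailingCoeff with hu₄
  have hu : ∀ b, ((yv B b).trailingCoeff).IsHomogeneous 1 := fun b => by
    rw [Polynomial.trailingCoeff]
    exact coeff_yv_isHomogeneous B _ _
  have hc0 : c ≠ 0 := by
    intro h0
    rw [h0, map_zero, zero_mul] at htc
    exact hT0 htc
  have hne : u₁ * u₂ * u₃ * u₄ ≠ 0 := by
    intro h0
    rw [h0, mul_zero, mul_zero] at htc
    exact hT0 htc
  have hdet : (Tmat (yform K (signStar K))).det =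
      MvPolynomial.C (2 * c) * (u₁ * u₂ * u₃ * u₄) := by
    rw [htc, map_mul]
    simp only [map_ofNat]
    ring
  have hdvd : qY K ∣ MvPolynomial.C (2 * c) * (u₁ * u₂ * u₃ * u₄) := by
    rw [← hdet, det_Tmat_yform_signStar]
    exact dvd_mul_right _ _
  have nd : ∀ b, (yv B b).trailingCoeff ≠ 0 → ¬ qY K ∣ (yv B b).trailingCoeff :=
    fun b hb =>
    not_dvd_of_isHomogeneous (qY_isHomogeneous K) (qY_prime K).ne_zero (hu b) hb
  simp only [mul_ne_zero_iff] at hne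
  obtain ⟨⟨⟨hne₁, hne₂⟩, hne₃⟩, hne₄⟩ := hne
  rcases (qY_prime K).dvd_or_dvd hdvd with h5 | h5
  · exact (qY_prime K).not_unit (isUnit_of_dvd_unit h5
      ((isUnit_iff_ne_zero.mpr (mul_ne_zero h2 hc0)).map MvPolynomial.C))
  rcases (qY_prime K).dvd_or_dvd h5 with h6 | h6
  · rcases (qY_prime K).dvd_or_dvd h6 with h7 | h7
    · rcases (qY_prime K).dvd_or_dvd h7 with h8 | h8
      · exact nd _ hne₁ h8
      · exact nd _ hne₂ h8
    · exact nd _ hne₃ h7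
  · exact nd _ hne₄ h6

/-- **The two sign twists are separated in characteristic `≠ 2`**: `𝔖^♭ᵀ ⋭ 𝔖^♭` (this file) —
together with `𝔖^♭ ⋭ 𝔖^♭ᵀ` (`FarEdgeDescentSignTwistComm`) and the determinant classes
(`FarEdgeDescentTwistDetClass`), the three generic twists `ᵀ, ♭, ♭ᵀ` of `n = 2` are pairwise
degeneration-incomparable at `N = 1`.
[cite: BurgisserClausenShokrollahi1997, (15.19), sec. 20.2] -/
theorem generic_twists_pairwise (h2 : (2 : K) ≠ 0) :
    ¬ AlgDegeneratesTo (signTStar K) (signStar K) ∧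
    (¬ AlgDegeneratesTo (signStar K) (twistedStar K 2 1) ∧
      ¬ AlgDegeneratesTo (twistedStar K 2 1) (signStar K)) ∧
    (¬ AlgDegeneratesTo (signTStar K) (twistedStar K 2 1) ∧
      ¬ AlgDegeneratesTo (twistedStar K 2 1) (signTStar K)) :=
  ⟨signTStar_not_algDegeneratesTo_signStar K h2, generic_twists_detClass_incomparable K h2⟩

end Main

end Summit.MatrixMultiplication.MatrixMultiplication.Theorems.FarEdgeDescentSignTwistYDet

end
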